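import Mathlib.Probability.Distributions.Gaussian.Fernique
import Literature.MathematicalPhysics.KineticTheory.HardSphereEulerProofs
import Summits.AtomisticToContinuum.HydrodynamicLimit.Theorems.OneFlightGossipEngineEnergyCurrentTailsLevelCensusObjects
import HarnessLib

/-!
# Energetic collision times: pathwise counting and the Gaussian tail of the energetic flux

Helper file of the crux line `registered` (birth skeleton) of `SpeedCapSurgery.MaxSpeedBoundLog`
(stmt-AtomisticToContinuum-9629), `--supports` that item. Two ingredients of the first-moment method
over ENERGETIC collisions (collision times whose colliding pair has outgoing kinetic energy above a
level `c²`), used by the dynamic stub `stub_energeticCollisionsRare` of the line in the calibration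
(homogeneous Gibbs) case and reusable verbatim in the general case:

* PATHWISE (`ncard_energetic_le_eventSum`, `eventSum_le_markSum`): on a good orbit the number of
  energetic collision times in `(0, t]` is at most the once-per-collision velocity-event count
  `eventSum Φ 0 t {(v⁻, v⁺) | c² < ‖v₁⁺‖² + ‖v₂⁺‖²}` of `Theorems.EnergyCurrentTailsLevelCensus`
  (each energetic collision time carries the ordered contact pair with the smaller label first; the
  torus geometry is regular at diameter `hsDiameter σ N ≤ σ < 1/2`), which in turn is at most the
  inline ordered-pair collision sum of the velocity mark `b(v, w) = 𝟙{c² < ‖v‖² + ‖w‖²}` over the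
  closed window `[0, t]` — the form consumed by the tree's collision-flux bounds
  (`localGibbsLaw_lintegral_le_of_le_collisionMarkSum`, Cercignani–Illner–Pulvirenti 1994 App. 4.A);
* GAUSSIAN TAIL OF THE ENERGETIC FLUX (`exists_flux_tail_bound`): for the isotropic Gaussian
  `N(0, θ)` of `ℝ³` there are `α > 0`, `K < ∞` with
  `∫ ‖w − v‖ 𝟙{c² < ‖v‖² + ‖w‖²} dN(0,θ)^{⊗2} ≤ K e^{-α c²}` for every level `c` (Fernique's theorem
  `ProbabilityTheory.IsGaussian.exists_integrable_exp_sq` for the exponential moment, the pointwise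
  Chernoff bound `norm_sub_mul_indicator_le`, Tonelli).

References: C. Cercignani, R. Illner, M. Pulvirenti, *The Mathematical Theory of Dilute Gases*
(1994), App. 4.A; X. Fernique, *Intégrabilité des vecteurs gaussiens*, C. R. Acad. Sci. 270 (1970).
-/

noncomputable section

open MeasureTheory ProbabilityTheory Set Filter Topology
open scoped ENNReal InnerProductSpace BigOperators

namespace Summit.AtomisticToContinuum.HydrodynamicLimit.Theorems.MaxSpeedBoundLogLine

open Literature.MathematicalPhysics.KineticTheory Literature.Analysis.FluidPDE
open Summit.AtomisticToContinuum.HydrodynamicLimit.Theorems.EnergyCurrentTailsLevelCensus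

/-! ## Pathwise: energetic collision times and the velocity-event count -/

/-- The velocity event "the OUTGOING pair has kinetic energy above `c²`" (a Borel set of velocity
events `((v₁⁻, v₂⁻), (v₁⁺, v₂⁺))`). -/
theorem measurableSet_energeticEvent (c : ℝ) :
    MeasurableSet {q : VelEvent | c ^ 2 < ‖q.2.1‖ ^ 2 + ‖q.2.2‖ ^ 2} :=
  measurableSet_lt measurable_const (by fun_prop)

/-- **Energetic collision times are counted by the velocity-event count.** On a good orbit of a flow
of the crux frame (`0 < σ < 1/2`, so that the torus geometry is regular at diameter
`hsDiameter σ N ≤ σ`), the number of collision times `r ∈ (0, t]` whose colliding pair has outgoing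
kinetic energy above `c²` is at most `eventSum Φ 0 t {c² < ‖v₁⁺‖² + ‖v₂⁺‖²}`: at such a time the
ordered contact pair with the smaller label first contributes `1` to the once-per-collision count. -/
theorem ncard_energetic_le_eventSum {σ : ℝ} (hσ : 0 < σ) (hσ2 : σ < 1 / 2) {N : ℕ} (Φ : Flow σ N)
    {z : Config (N + 1) (Fin 3) T3} (hz : z ∈ Φ.good) (c t : ℝ) :
    ((Set.ncard {r ∈ Set.Ioc 0 t | ∃ i j : Fin (N + 1), i ≠ j ∧
        Φ.flow r z ∈ contactSet (Torus.geometry (Fin 3)) (N + 1) (hsDiameter σ N) i j ∧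
        c ^ 2 < ‖(Φ.flow r z i).2‖ ^ 2 + ‖(Φ.flow r z j).2‖ ^ 2} : ℕ) : ℝ≥0∞) ≤
      eventSum Φ 0 t {q : VelEvent | c ^ 2 < ‖q.2.1‖ ^ 2 + ‖q.2.2‖ ^ 2} z := by
  classical
  set ε := hsDiameter σ N with hε
  have hεlt : ε < 2⁻¹ := (hsDiameter_le hσ.le N).trans_lt (by norm_num at hσ2 ⊢; linarith)
  have hG := Torus.isHardSphereRegular_geometry (d := Fin 3) hεlt
  set γ : ℝ → Config (N + 1) (Fin 3) T3 := fun s => Φ.flow s z with hγ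
  have htraj : IsHardSphereTrajectory (Torus.geometry (Fin 3)) ε (N + 1) γ := Φ.isTrajectory z hz
  have hfin : (collisionTimes (Torus.geometry (Fin 3)) ε γ ∩ Ioc 0 t).Finite :=
    htraj.finite_collisionTimes_inter_of_subset_Icc Ioc_subset_Icc_self
  set S : Set VelEvent := {q | c ^ 2 < ‖q.2.1‖ ^ 2 + ‖q.2.2‖ ^ 2} with hS
  set E : Set ℝ := {r ∈ Set.Ioc 0 t | ∃ i j : Fin (N + 1), i ≠ j ∧
      Φ.flow r z ∈ contactSet (Torus.geometry (Fin 3)) (N + 1) ε i j ∧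
      c ^ 2 < ‖(Φ.flow r z i).2‖ ^ 2 + ‖(Φ.flow r z j).2‖ ^ 2} with hE
  have hEsub : E ⊆ collisionTimes (Torus.geometry (Fin 3)) ε γ ∩ Ioc 0 t := by
    rintro r ⟨hr, i, j, hij, hc, -⟩
    exact ⟨⟨i, j, hij, hc⟩, hr⟩
  have hEfin : E.Finite := hfin.subset hEsub
  -- the inner sum of the velocity-event count at a collision time
  set inner : ℝ → ℝ≥0∞ := fun s => ∑ p ∈ contactPairs (Torus.geometry (Fin 3)) ε (γ s),
    (if (HardSphereCollisionRecord.ofConfig (Torus.geometry (Fin 3)) ε (γ s) s p.1 p.2).fst <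
        (HardSphereCollisionRecord.ofConfig (Torus.geometry (Fin 3)) ε (γ s) s p.1 p.2).snd then
      S.indicator (fun _ => (1 : ℝ≥0∞))
        ((HardSphereCollisionRecord.ofConfig (Torus.geometry (Fin 3)) ε (γ s) s p.1 p.2).preVel,
          (HardSphereCollisionRecord.ofConfig (Torus.geometry (Fin 3)) ε (γ s) s p.1 p.2).postVel)
      else 0) with hinner
  have hsum : eventSum Φ 0 t S z = ∑ s ∈ hfin.toFinset, inner s := by
    rw [eventSum, HardSphereFlow.collisionSum_eq, collisionSum_eq_finset_sum hfin]
  -- at an energetic collision time the inner sum is at least `1`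
  have hone : ∀ r ∈ E, (1 : ℝ≥0∞) ≤ inner r := by
    rintro r ⟨-, i, j, hij, hc, hen⟩
    -- order the pair with the smaller label first
    obtain ⟨p, q, hpq, hc', hen'⟩ : ∃ p q : Fin (N + 1), p < q ∧
        γ r ∈ contactSet (Torus.geometry (Fin 3)) (N + 1) ε p q ∧
        c ^ 2 < ‖(γ r p).2‖ ^ 2 + ‖(γ r q).2‖ ^ 2 := by
      rcases lt_or_gt_of_ne hij with h | h
      · exact ⟨i, j, h, hc, hen⟩
      · refine ⟨j, i, h, (hG.mem_contactSet_comm).1 hc, ?_⟩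
        rwa [add_comm]
    have hmem : (p, q) ∈ contactPairs (Torus.geometry (Fin 3)) ε (γ r) :=
      mem_contactPairs.2 ⟨hpq.ne, hc'⟩
    have hterm : (1 : ℝ≥0∞) ≤ (if (HardSphereCollisionRecord.ofConfig (Torus.geometry (Fin 3)) ε (γ r) r p q).fst <
        (HardSphereCollisionRecord.ofConfig (Torus.geometry (Fin 3)) ε (γ r) r p q).snd then
      S.indicator (fun _ => (1 : ℝ≥0∞))
        ((HardSphereCollisionRecord.ofConfig (Torus.geometry (Fin 3)) ε (γ r) r p q).preVel,
          (HardSphereCollisionRecord.ofConfig (Torus.geometry (Fin 3)) ε (γ r) r p q).postVel)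
      else 0) := by
      simp only [HardSphereCollisionRecord.ofConfig_fst, HardSphereCollisionRecord.ofConfig_snd,
        if_pos hpq, HardSphereCollisionRecord.ofConfig_postVel]
      rw [indicator_of_mem (by exact hen')]
    exact hterm.trans (Finset.single_le_sum (f := fun p : Fin (N + 1) × Fin (N + 1) =>
      (if (HardSphereCollisionRecord.ofConfig (Torus.geometry (Fin 3)) ε (γ r) r p.1 p.2).fst <
          (HardSphereCollisionRecord.ofConfig (Torus.geometry (Fin 3)) ε (γ r) r p.1 p.2).snd then
        S.indicator (fun _ => (1 : ℝ≥0∞))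
          ((HardSphereCollisionRecord.ofConfig (Torus.geometry (Fin 3)) ε (γ r) r p.1 p.2).preVel,
            (HardSphereCollisionRecord.ofConfig (Torus.geometry (Fin 3)) ε (γ r) r p.1 p.2).postVel)
        else 0)) (fun _ _ => bot_le) hmem)
  calc ((Set.ncard E : ℕ) : ℝ≥0∞) = ((hEfin.toFinset.card : ℕ) : ℝ≥0∞) := by
        rw [Set.ncard_eq_toFinset_card E hEfin]
    _ = ∑ _r ∈ hEfin.toFinset, (1 : ℝ≥0∞) := by simp
    _ ≤ ∑ r ∈ hEfin.toFinset, inner r :=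
        Finset.sum_le_sum fun r hr => hone r ((Set.Finite.mem_toFinset hEfin).1 hr)
    _ ≤ ∑ s ∈ hfin.toFinset, inner s :=
        Finset.sum_le_sum_of_subset_of_nonneg
          (fun r hr => (Set.Finite.mem_toFinset hfin).2 (hEsub ((Set.Finite.mem_toFinset hEfin).1 hr)))
          (fun _ _ _ => bot_le)
    _ = eventSum Φ 0 t S z := hsum.symm

/-- **The velocity-event count is dominated by the ordered-pair mark sum over `[0, t]`.** On a good
orbit, `eventSum Φ 0 t {c² < ‖v₁⁺‖² + ‖v₂⁺‖²}` is at most the inline ordered-pair collision sum of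
the velocity mark `𝟙{c² < ‖v_i‖² + ‖v_j‖²}` of the current (post-collisional) velocities over the
closed window `[0, t]` — the form consumed by the collision-flux bound
`localGibbsLaw_lintegral_le_of_le_collisionMarkSum` (dropping the once-per-collision guard and
enlarging the window only increase a sum of non-negative terms). -/
theorem eventSum_le_markSum {σ : ℝ} (hσ : 0 < σ) {N : ℕ} (Φ : Flow σ N)
    {z : Config (N + 1) (Fin 3) T3} (hz : z ∈ Φ.good) (c t : ℝ) :
    eventSum Φ 0 t {q : VelEvent | c ^ 2 < ‖q.2.1‖ ^ 2 + ‖q.2.2‖ ^ 2} z ≤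
      ∑ᶠ s ∈ collisionTimes (Torus.geometry (Fin 3)) (hsDiameter σ N) (fun r => Φ.flow r z) ∩ Icc 0 t,
        ∑ i : Fin (N + 1), ∑ j : Fin (N + 1),
          (if i ≠ j ∧ ‖(Torus.geometry (Fin 3)).sepVec (Φ.flow s z i).1 (Φ.flow s z j).1‖ =
              hsDiameter σ N then
            Set.indicator {p : V3 × V3 | c ^ 2 < ‖p.1‖ ^ 2 + ‖p.2‖ ^ 2} (fun _ => (1 : ℝ≥0∞))
              ((Φ.flow s z i).2, (Φ.flow s z j).2) else 0) := by
  classical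
  have _ := hσ
  set ε := hsDiameter σ N with hε
  set γ : ℝ → Config (N + 1) (Fin 3) T3 := fun s => Φ.flow s z with hγ
  have htraj : IsHardSphereTrajectory (Torus.geometry (Fin 3)) ε (N + 1) γ := Φ.isTrajectory z hz
  have hfinIoc : (collisionTimes (Torus.geometry (Fin 3)) ε γ ∩ Ioc 0 t).Finite :=
    htraj.finite_collisionTimes_inter_of_subset_Icc Ioc_subset_Icc_self
  have hfinIcc : (collisionTimes (Torus.geometry (Fin 3)) ε γ ∩ Icc 0 t).Finite :=
    htraj.finite_collisionTimes_inter_of_subset_Icc Subset.rfl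
  set S : Set VelEvent := {q | c ^ 2 < ‖q.2.1‖ ^ 2 + ‖q.2.2‖ ^ 2} with hS
  set b : V3 × V3 → ℝ≥0∞ :=
    Set.indicator {p : V3 × V3 | c ^ 2 < ‖p.1‖ ^ 2 + ‖p.2‖ ^ 2} (fun _ => (1 : ℝ≥0∞)) with hb
  -- the right-hand side as a finite sum over contact pairs
  have hrhs : (∑ᶠ s ∈ collisionTimes (Torus.geometry (Fin 3)) ε γ ∩ Icc 0 t,
      ∑ i : Fin (N + 1), ∑ j : Fin (N + 1),
        (if i ≠ j ∧ ‖(Torus.geometry (Fin 3)).sepVec (γ s i).1 (γ s j).1‖ = ε then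
          b ((γ s i).2, (γ s j).2) else 0)) =
      ∑ s ∈ hfinIcc.toFinset, ∑ p ∈ contactPairs (Torus.geometry (Fin 3)) ε (γ s),
        b ((γ s p.1).2, (γ s p.2).2) := by
    rw [finsum_mem_eq_finite_toFinset_sum _ hfinIcc]
    refine Finset.sum_congr rfl fun s _ => ?_
    rw [← sum_contactPairs_eq (htraj.mem s) (fun i j => b ((γ s i).2, (γ s j).2))]
  have hlhs : eventSum Φ 0 t S z = ∑ s ∈ hfinIoc.toFinset,
      ∑ p ∈ contactPairs (Torus.geometry (Fin 3)) ε (γ s),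
        (if (HardSphereCollisionRecord.ofConfig (Torus.geometry (Fin 3)) ε (γ s) s p.1 p.2).fst <
            (HardSphereCollisionRecord.ofConfig (Torus.geometry (Fin 3)) ε (γ s) s p.1 p.2).snd then
          S.indicator (fun _ => (1 : ℝ≥0∞))
            ((HardSphereCollisionRecord.ofConfig (Torus.geometry (Fin 3)) ε (γ s) s p.1 p.2).preVel,
              (HardSphereCollisionRecord.ofConfig (Torus.geometry (Fin 3)) ε (γ s) s p.1 p.2).postVel)
          else 0) := by
    rw [eventSum, HardSphereFlow.collisionSum_eq, collisionSum_eq_finset_sum hfinIoc]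
  -- termwise: dropping the guard `fst < snd` only increases the summand
  have hterm : ∀ (s : ℝ) (p : Fin (N + 1) × Fin (N + 1)),
      (if (HardSphereCollisionRecord.ofConfig (Torus.geometry (Fin 3)) ε (γ s) s p.1 p.2).fst <
            (HardSphereCollisionRecord.ofConfig (Torus.geometry (Fin 3)) ε (γ s) s p.1 p.2).snd then
          S.indicator (fun _ => (1 : ℝ≥0∞))
            ((HardSphereCollisionRecord.ofConfig (Torus.geometry (Fin 3)) ε (γ s) s p.1 p.2).preVel,
              (HardSphereCollisionRecord.ofConfig (Torus.geometry (Fin 3)) ε (γ s) s p.1 p.2).postVel)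
          else 0) ≤ b ((γ s p.1).2, (γ s p.2).2) := by
    intro s p
    split_ifs with h
    · simp only [HardSphereCollisionRecord.ofConfig_postVel, hb, hS]
      by_cases hmem : c ^ 2 < ‖(γ s p.1).2‖ ^ 2 + ‖(γ s p.2).2‖ ^ 2
      · rw [indicator_of_mem (show ((HardSphereCollisionRecord.ofConfig (Torus.geometry (Fin 3)) ε
            (γ s) s p.1 p.2).preVel, ((γ s p.1).2, (γ s p.2).2)) ∈
            {q : VelEvent | c ^ 2 < ‖q.2.1‖ ^ 2 + ‖q.2.2‖ ^ 2} from hmem),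
          indicator_of_mem (show ((γ s p.1).2, (γ s p.2).2) ∈
            {p : V3 × V3 | c ^ 2 < ‖p.1‖ ^ 2 + ‖p.2‖ ^ 2} from hmem)]
      · rw [indicator_of_notMem (show ((HardSphereCollisionRecord.ofConfig (Torus.geometry (Fin 3)) ε
            (γ s) s p.1 p.2).preVel, ((γ s p.1).2, (γ s p.2).2)) ∉
            {q : VelEvent | c ^ 2 < ‖q.2.1‖ ^ 2 + ‖q.2.2‖ ^ 2} from hmem)]
        exact bot_le
    · exact bot_le
  rw [hlhs, hrhs]
  calc ∑ s ∈ hfinIoc.toFinset, ∑ p ∈ contactPairs (Torus.geometry (Fin 3)) ε (γ s),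
        (if (HardSphereCollisionRecord.ofConfig (Torus.geometry (Fin 3)) ε (γ s) s p.1 p.2).fst <
            (HardSphereCollisionRecord.ofConfig (Torus.geometry (Fin 3)) ε (γ s) s p.1 p.2).snd then
          S.indicator (fun _ => (1 : ℝ≥0∞))
            ((HardSphereCollisionRecord.ofConfig (Torus.geometry (Fin 3)) ε (γ s) s p.1 p.2).preVel,
              (HardSphereCollisionRecord.ofConfig (Torus.geometry (Fin 3)) ε (γ s) s p.1 p.2).postVel)
          else 0)
      ≤ ∑ s ∈ hfinIoc.toFinset, ∑ p ∈ contactPairs (Torus.geometry (Fin 3)) ε (γ s),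
          b ((γ s p.1).2, (γ s p.2).2) :=
        Finset.sum_le_sum fun s _ => Finset.sum_le_sum fun p _ => hterm s p
    _ ≤ ∑ s ∈ hfinIcc.toFinset, ∑ p ∈ contactPairs (Torus.geometry (Fin 3)) ε (γ s),
          b ((γ s p.1).2, (γ s p.2).2) := by
        refine Finset.sum_le_sum_of_subset_of_nonneg (fun s hs => ?_) (fun _ _ _ => bot_le)
        rw [Set.Finite.mem_toFinset] at hs ⊢
        exact ⟨hs.1, Ioc_subset_Icc_self hs.2⟩

/-! ## The Gaussian tail of the energetic contact flux -/

/-- Elementary: `x ≤ (1 + α⁻¹) e^{α x²}` for `α > 0` (`x ≤ 1 + x²`, `1 + αy ≤ e^{αy}`). -/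
theorem le_const_mul_exp_mul_sq {α : ℝ} (hα : 0 < α) (x : ℝ) :
    x ≤ (1 + α⁻¹) * Real.exp (α * x ^ 2) := by
  have h1 : x ≤ 1 + x ^ 2 := by nlinarith [sq_nonneg (x - 1 / 2)]
  have h2 : α * x ^ 2 + 1 ≤ Real.exp (α * x ^ 2) := Real.add_one_le_exp _
  have h3 : 1 ≤ Real.exp (α * x ^ 2) := Real.one_le_exp (by positivity)
  have h4 : x ^ 2 ≤ α⁻¹ * Real.exp (α * x ^ 2) := by
    rw [le_inv_mul_iff₀ hα]
    linarith
  calc x ≤ 1 + x ^ 2 := h1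
    _ ≤ Real.exp (α * x ^ 2) + α⁻¹ * Real.exp (α * x ^ 2) := add_le_add h3 h4
    _ = (1 + α⁻¹) * Real.exp (α * x ^ 2) := by ring

/-- **Pointwise Chernoff bound for the energetic flux mark.** For `α > 0`,
`‖w − v‖ 𝟙{c² < ‖v‖² + ‖w‖²} ≤ 2(1 + α⁻¹) e^{-α c²} e^{2α‖v‖²} e^{2α‖w‖²}`. -/
theorem norm_sub_mul_indicator_le {α : ℝ} (hα : 0 < α) (c : ℝ) (p : V3 × V3) :
    ‖p.2 - p.1‖ * Set.indicator {p : V3 × V3 | c ^ 2 < ‖p.1‖ ^ 2 + ‖p.2‖ ^ 2} (fun _ => (1 : ℝ)) p ≤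
      2 * (1 + α⁻¹) * Real.exp (-(α * c ^ 2)) *
        (Real.exp (2 * α * ‖p.1‖ ^ 2) * Real.exp (2 * α * ‖p.2‖ ^ 2)) := by
  have hK : 0 ≤ 1 + α⁻¹ := by positivity
  by_cases hmem : p ∈ {p : V3 × V3 | c ^ 2 < ‖p.1‖ ^ 2 + ‖p.2‖ ^ 2}
  · rw [indicator_of_mem hmem, mul_one]
    have hc : c ^ 2 < ‖p.1‖ ^ 2 + ‖p.2‖ ^ 2 := hmem
    -- `‖w - v‖ ≤ ‖v‖ + ‖w‖ ≤ (1 + α⁻¹)(e^{α‖v‖²} + e^{α‖w‖²}) ≤ 2(1 + α⁻¹) e^{α‖v‖²} e^{α‖w‖²}`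
    have h1 : ‖p.2 - p.1‖ ≤ ‖p.1‖ + ‖p.2‖ := by
      calc ‖p.2 - p.1‖ ≤ ‖p.2‖ + ‖p.1‖ := norm_sub_le _ _
        _ = ‖p.1‖ + ‖p.2‖ := add_comm _ _
    have hA := le_const_mul_exp_mul_sq hα ‖p.1‖
    have hB := le_const_mul_exp_mul_sq hα ‖p.2‖
    have hea : 1 ≤ Real.exp (α * ‖p.1‖ ^ 2) := Real.one_le_exp (by positivity)
    have heb : 1 ≤ Real.exp (α * ‖p.2‖ ^ 2) := Real.one_le_exp (by positivity)
    have h2 : Real.exp (α * ‖p.1‖ ^ 2) + Real.exp (α * ‖p.2‖ ^ 2) ≤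
        2 * (Real.exp (α * ‖p.1‖ ^ 2) * Real.exp (α * ‖p.2‖ ^ 2)) := by
      nlinarith [Real.exp_pos (α * ‖p.1‖ ^ 2), Real.exp_pos (α * ‖p.2‖ ^ 2)]
    have h3 : ‖p.2 - p.1‖ ≤ 2 * (1 + α⁻¹) * (Real.exp (α * ‖p.1‖ ^ 2) * Real.exp (α * ‖p.2‖ ^ 2)) := by
      calc ‖p.2 - p.1‖ ≤ (1 + α⁻¹) * Real.exp (α * ‖p.1‖ ^ 2) + (1 + α⁻¹) * Real.exp (α * ‖p.2‖ ^ 2) :=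
            h1.trans (add_le_add hA hB)
        _ = (1 + α⁻¹) * (Real.exp (α * ‖p.1‖ ^ 2) + Real.exp (α * ‖p.2‖ ^ 2)) := by ring
        _ ≤ (1 + α⁻¹) * (2 * (Real.exp (α * ‖p.1‖ ^ 2) * Real.exp (α * ‖p.2‖ ^ 2))) :=
            mul_le_mul_of_nonneg_left h2 hK
        _ = 2 * (1 + α⁻¹) * (Real.exp (α * ‖p.1‖ ^ 2) * Real.exp (α * ‖p.2‖ ^ 2)) := by ring
    -- the level: `1 ≤ e^{-αc²} e^{α(‖v‖² + ‖w‖²)}`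
    have h4 : 1 ≤ Real.exp (-(α * c ^ 2)) * (Real.exp (α * ‖p.1‖ ^ 2) * Real.exp (α * ‖p.2‖ ^ 2)) := by
      rw [← Real.exp_add, ← Real.exp_add]
      refine Real.one_le_exp ?_
      nlinarith
    have h5 : 0 ≤ 2 * (1 + α⁻¹) * (Real.exp (α * ‖p.1‖ ^ 2) * Real.exp (α * ‖p.2‖ ^ 2)) := by positivity
    calc ‖p.2 - p.1‖ ≤ 2 * (1 + α⁻¹) * (Real.exp (α * ‖p.1‖ ^ 2) * Real.exp (α * ‖p.2‖ ^ 2)) * 1 := by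
          rw [mul_one]; exact h3
      _ ≤ 2 * (1 + α⁻¹) * (Real.exp (α * ‖p.1‖ ^ 2) * Real.exp (α * ‖p.2‖ ^ 2)) *
            (Real.exp (-(α * c ^ 2)) * (Real.exp (α * ‖p.1‖ ^ 2) * Real.exp (α * ‖p.2‖ ^ 2))) :=
          mul_le_mul_of_nonneg_left h4 h5
      _ = 2 * (1 + α⁻¹) * Real.exp (-(α * c ^ 2)) *
            (Real.exp (2 * α * ‖p.1‖ ^ 2) * Real.exp (2 * α * ‖p.2‖ ^ 2)) := by
          have ha : Real.exp (2 * α * ‖p.1‖ ^ 2) = Real.exp (α * ‖p.1‖ ^ 2) * Real.exp (α * ‖p.1‖ ^ 2) := by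
            rw [← Real.exp_add]; ring_nf
          have hb' : Real.exp (2 * α * ‖p.2‖ ^ 2) = Real.exp (α * ‖p.2‖ ^ 2) * Real.exp (α * ‖p.2‖ ^ 2) := by
            rw [← Real.exp_add]; ring_nf
          rw [ha, hb']; ring
  · rw [indicator_of_notMem hmem, mul_zero]
    positivity

/-- **The energetic contact flux under a Gaussian pair law has a Gaussian tail in the level.** For
the isotropic Gaussian `N(0, θ)` of `ℝ³` there are `α > 0` and `K < ∞` with
`∫ ‖w − v‖ 𝟙{c² < ‖v‖² + ‖w‖²} dN(0,θ)(v) dN(0,θ)(w) ≤ K e^{-α c²}` for every level `c`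
(Fernique's theorem for `N(0, θ)` gives the exponential moment; pointwise Chernoff bound
`norm_sub_mul_indicator_le`; Tonelli). -/
theorem exists_flux_tail_bound :
    ∀ θ : ℝ, ∃ α : ℝ, 0 < α ∧ ∃ K : ENNReal, K < ⊤ ∧ ∀ c : ℝ, ∫⁻ p, ENNReal.ofReal ‖p.2 - p.1‖ *
      Set.indicator {p : Literature.MathematicalPhysics.KineticTheory.V3 ×
      Literature.MathematicalPhysics.KineticTheory.V3 | c ^ 2 < ‖p.1‖ ^ 2 + ‖p.2‖ ^ 2} (fun _ => (1
      : ENNReal)) p ∂((Literature.MathematicalPhysics.KineticTheory.gaussMeasure (0 :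
      Literature.MathematicalPhysics.KineticTheory.V3) θ).prod
      (Literature.MathematicalPhysics.KineticTheory.gaussMeasure (0 :
      Literature.MathematicalPhysics.KineticTheory.V3) θ)) ≤ K * ENNReal.ofReal (Real.exp (-(α * c ^
      2))) := by
  intro θ
  obtain ⟨C, hC, hint⟩ := IsGaussian.exists_integrable_exp_sq (gaussMeasure (0 : V3) θ)
  set γ := gaussMeasure (0 : V3) θ with hγ
  set α : ℝ := C / 2 with hα
  have hα0 : 0 < α := by positivity
  have h2α : 2 * α = C := by rw [hα]; ring
  set I : ℝ≥0∞ := ∫⁻ v, ENNReal.ofReal (Real.exp (C * ‖v‖ ^ 2)) ∂γ with hI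
  have hItop : I < ⊤ := hint.lintegral_lt_top
  refine ⟨α, hα0, ENNReal.ofReal (2 * (1 + α⁻¹)) * (I * I), ?_, fun c => ?_⟩
  · exact ENNReal.mul_lt_top ENNReal.ofReal_lt_top (ENNReal.mul_lt_top hItop hItop)
  have hem : Measurable fun v : V3 => ENNReal.ofReal (Real.exp (C * ‖v‖ ^ 2)) := by fun_prop
  -- pointwise bound, in `ℝ≥0∞`
  have hpt : ∀ p : V3 × V3, ENNReal.ofReal ‖p.2 - p.1‖ *
      Set.indicator {p : V3 × V3 | c ^ 2 < ‖p.1‖ ^ 2 + ‖p.2‖ ^ 2} (fun _ => (1 : ℝ≥0∞)) p ≤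
      ENNReal.ofReal (2 * (1 + α⁻¹)) * ENNReal.ofReal (Real.exp (-(α * c ^ 2))) *
        (ENNReal.ofReal (Real.exp (C * ‖p.1‖ ^ 2)) * ENNReal.ofReal (Real.exp (C * ‖p.2‖ ^ 2))) := by
    intro p
    have h := norm_sub_mul_indicator_le hα0 c p
    rw [h2α] at h
    have hind : Set.indicator {p : V3 × V3 | c ^ 2 < ‖p.1‖ ^ 2 + ‖p.2‖ ^ 2} (fun _ => (1 : ℝ≥0∞)) p =
        ENNReal.ofReal (Set.indicator {p : V3 × V3 | c ^ 2 < ‖p.1‖ ^ 2 + ‖p.2‖ ^ 2}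
          (fun _ => (1 : ℝ)) p) := by
      by_cases hm : p ∈ {p : V3 × V3 | c ^ 2 < ‖p.1‖ ^ 2 + ‖p.2‖ ^ 2}
      · rw [indicator_of_mem hm, indicator_of_mem hm, ENNReal.ofReal_one]
      · rw [indicator_of_notMem hm, indicator_of_notMem hm, ENNReal.ofReal_zero]
    rw [hind, ← ENNReal.ofReal_mul (norm_nonneg _), ← ENNReal.ofReal_mul (by positivity),
      ← ENNReal.ofReal_mul (Real.exp_nonneg _), ← ENNReal.ofReal_mul (by positivity)]
    exact ENNReal.ofReal_le_ofReal h
  calc ∫⁻ p, ENNReal.ofReal ‖p.2 - p.1‖ *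
          Set.indicator {p : V3 × V3 | c ^ 2 < ‖p.1‖ ^ 2 + ‖p.2‖ ^ 2} (fun _ => (1 : ℝ≥0∞)) p
        ∂(γ.prod γ)
      ≤ ∫⁻ p, ENNReal.ofReal (2 * (1 + α⁻¹)) * ENNReal.ofReal (Real.exp (-(α * c ^ 2))) *
          (ENNReal.ofReal (Real.exp (C * ‖p.1‖ ^ 2)) * ENNReal.ofReal (Real.exp (C * ‖p.2‖ ^ 2)))
        ∂(γ.prod γ) := lintegral_mono hpt
    _ = ENNReal.ofReal (2 * (1 + α⁻¹)) * ENNReal.ofReal (Real.exp (-(α * c ^ 2))) *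
          ∫⁻ p, ENNReal.ofReal (Real.exp (C * ‖p.1‖ ^ 2)) * ENNReal.ofReal (Real.exp (C * ‖p.2‖ ^ 2))
            ∂(γ.prod γ) := by
        rw [lintegral_const_mul]
        exact (hem.comp measurable_fst).mul (hem.comp measurable_snd)
    _ = ENNReal.ofReal (2 * (1 + α⁻¹)) * ENNReal.ofReal (Real.exp (-(α * c ^ 2))) * (I * I) := by
        rw [lintegral_prod_mul hem.aemeasurable hem.aemeasurable]
    _ = ENNReal.ofReal (2 * (1 + α⁻¹)) * (I * I) * ENNReal.ofReal (Real.exp (-(α * c ^ 2))) := by ring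

end Summit.AtomisticToContinuum.HydrodynamicLimit.Theorems.MaxSpeedBoundLogLine

end
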